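import Literature.NumberTheory.Automorphic.ParabolicGLProofs
import Literature.NumberTheory.Automorphic.ParabolicInductionProofs
import Literature.NumberTheory.Automorphic.ParabolicInductionQuotientProofs
import HarnessLib

/-!
# The modulus character of `P_c` on the unipotent radical and on the Levi; Frobenius assembly
(sibling proof file towards `Literature.NumberTheory.Automorphic.bernsteinZelevinsky_support`)

Let `F` be a non-archimedean local field, `c : n → α` a block labelling and `P_c = M_c U_c` the
standard parabolic subgroup of `GL_n(F)` (`Literature.NumberTheory.Automorphic.standardParabolicGL`).
This file proves:

* `rootDeltaChar_eq_rootDeltaChar_leviEmbeddingP`: `δ^{1/2}(p) = δ^{1/2}(m)` for `p = m u` (from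
  `rootDeltaChar_eq_one_of_mem_unipotentRadicalP` of `ParabolicInductionProofs`: `δ_{P_c}^{1/2}` is
  trivial on `U_c`, Bernstein–Zelevinsky 1977, 1.8);
  `isOpen_ker_rootDeltaChar_comp_leviEmbeddingP`: the character `δ_{P_c}^{1/2} ∘ emb` of the Levi
  `Π_a GL_{n_a}(F)` is smooth (open kernel) — it is trivial on `emb⁻¹(K₀ ∩ P_c)` for a compact
  open `K₀ ≤ GL_n(F)` (`modularCharacter_eq_one_of_mem_comap_conj` of `ParabolicGLProofs`);
* `jacquetGL_leviProjection_mk`: `P_c` acts on the Jacquet module `r_c π` through its Levi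
  quotient, `[π(p) v] = r_c π (proj p) [v]`; `Representation.IsSmooth.jacquetGL`: `r_c π` is smooth
  for smooth `π`;
* `Representation.finite_asModule_jacquetGL` (**Jacquet modules of irreducible smooth
  representations are finitely generated** over the group algebra of the Levi; Bernstein–Zelevinsky
  1977, Prop. 2.3 with 1.9 (c)/(e): `r` preserves finite type since `G` is compact modulo `P`):
  by the Iwasawa decomposition `GL_n(F) = P_c K₀` (`exists_isCompact_isOpen_forall_standardParabolicGL_mul`
  of `ParabolicGLProofs`) and smoothness, the `GL_n(F)`-orbit of a vector `v₀` is
  `P_c · {π(s) v₀ : s ∈ t}` for a finite `t`, so the classes `[π(s) v₀]` generate `r_c π`; hence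
  (`Representation.exists_isCoatom_subrepresentation_jacquetGL`) a non-zero Jacquet module of an
  irreducible smooth `π` has a maximal proper subrepresentation, i.e. an irreducible quotient
  (`ParabolicInductionQuotientProofs`);
* `Representation.exists_injective_intertwiningMap_parabolicIndGL` (**Frobenius assembly**):
  for an irreducible smooth `π` of `GL_n(F)` and a non-zero `M_c`-map `ψ : r_c π → σ₀`, the vector
  `v ↦ (g ↦ ψ [π(g) v])` is an injective intertwining map
  `π ↪ i_c (σ₀ ⊗ (δ^{1/2} ∘ emb)⁻¹)` (`Representation.parabolicIndGL`; Bernstein–Zelevinsky 1977,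
  Prop. 1.9 (b) and 2.4 (d): `Hom(π, i σ) = Hom(r π, σ)`, with `Representation.frobeniusInv` of
  `SmoothInduction` and `Representation.IsIrreducible.injective_or_eq_zero`), together with the
  irreducibility and smoothness of the twisted datum `σ₀ ⊗ (δ^{1/2} ∘ emb)⁻¹`.

No new definitions, no named facts: theorems only. The continuity lemma for the Levi embedding
is a private copy of `Literature.NumberTheory.Automorphic.continuous_blockDiagonalGL` of
`ParabolicSemidirect` (not imported, to keep the adelic integration theory out of the dependency
cone, as in `ParabolicGLProofs`).

## References

* I. N. Bernstein, A. V. Zelevinsky, *Induced representations of reductive `p`-adic groups I*,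
  Ann. Sci. ÉNS 10 (1977), 1.7–1.9, §2.3, Thm. 2.5 (held: doi:10.24033/asens.1333, pp. 444–447).
* I. N. Bernstein, A. V. Zelevinsky, *Representations of the group `GL(n, F)` where `F` is a
  non-archimedean local field*, Russian Math. Surveys 31:3 (1976), §3.
* W. Casselman, *Introduction to the theory of admissible representations of `p`-adic reductive
  groups* (1995 notes), §1.5, §3.
-/

noncomputable section

open scoped MatrixGroups NNReal Topology
open MeasureTheory

namespace Literature.NumberTheory.Automorphic

/-! ### The Levi decomposition `p = m · u` and the action of `P_c` on the Jacquet module -/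

section Algebra

variable (R : Type*) [CommRing R] {n : Type*} [Fintype n] [DecidableEq n]
  {α : Type*} [LinearOrder α] [Fintype α] (c : n → α)

/-- `p = emb (proj p) · (emb (proj p))⁻¹ p` in `GL_n(R)`. [folklore] -/
theorem coe_eq_blockDiagonalGL_leviProjection_mul (p : standardParabolicGL R c) :
    (p : GL n R) = blockDiagonalGL R c (leviProjection R c p) *
      (((leviEmbeddingP R c (leviProjection R c p))⁻¹ * p : standardParabolicGL R c) : GL n R) := by
  rw [Subgroup.coe_mul, Subgroup.coe_inv, coe_leviEmbeddingP, mul_inv_cancel_left]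

variable {k : Type*} [CommRing k] {V : Type*} [AddCommGroup V] [Module k V]

/-- **`P_c` acts on the Jacquet module through its Levi quotient**: for `p ∈ P_c`,
`r_c π (proj p) [v] = [π(p) v]`, since `p = m u` with `u ∈ U_c` acting trivially on
`U_c`-coinvariants. (Bernstein–Zelevinsky 1977, §1.8.) [cite: BernsteinZelevinsky1977, §1.8] -/
theorem jacquetGL_leviProjection_mk (π : Representation k (GL n R) V) (p : standardParabolicGL R c)
    (v : V) :
    Representation.jacquetGL R c π (leviProjection R c p)
        (Representation.Coinvariants.mk (Representation.restrictUnipotentGL R c π) v) =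
      Representation.Coinvariants.mk (Representation.restrictUnipotentGL R c π) (π p v) := by
  set u : unipotentRadicalP R c :=
    ⟨(leviEmbeddingP R c (leviProjection R c p))⁻¹ * p, by
      rw [MonoidHom.mem_ker, map_mul, map_inv, leviProjection_leviEmbeddingP_apply, inv_mul_cancel]⟩
    with hu
  have hp : (p : GL n R) = blockDiagonalGL R c (leviProjection R c p) *
      ((u : standardParabolicGL R c) : GL n R) :=
    coe_eq_blockDiagonalGL_leviProjection_mul R c p
  conv_rhs => rw [hp, map_mul, Module.End.mul_apply]
  rw [← Representation.jacquetGL_mk]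
  congr 1
  exact (Representation.Coinvariants.mk_self_apply (Representation.restrictUnipotentGL R c π) u v).symm

end Algebra

/-! ### The modulus character is trivial on `U_c`; smoothness of `δ^{1/2}` on the Levi -/

section Modulus

variable (F : Type*) [Field F] [ValuativeRel F] [TopologicalSpace F] [IsNonarchimedeanLocalField F]
  {n : Type*} [Fintype n] [DecidableEq n] {α : Type*} [LinearOrder α] [Fintype α] (c : n → α)

/-- `δ_{P_c}^{1/2}(p) = δ_{P_c}^{1/2}(emb (proj p))`: the modulus only depends on the Levi component
(`p = m u` and `δ^{1/2}(u) = 1`, the latter being `rootDeltaChar_eq_one_of_mem_unipotentRadicalP`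
of `ParabolicInductionProofs`). (Bernstein–Zelevinsky 1977, 1.8–1.9.)
[cite: BernsteinZelevinsky1977, 1.8–1.9] -/
theorem rootDeltaChar_eq_rootDeltaChar_leviEmbeddingP (p : standardParabolicGL F c) :
    rootDeltaChar (standardParabolicGL F c) p =
      rootDeltaChar (standardParabolicGL F c) (leviEmbeddingP F c (leviProjection F c p)) := by
  conv_lhs => rw [← mul_inv_cancel_left (leviEmbeddingP F c (leviProjection F c p)) p]
  rw [map_mul, rootDeltaChar_eq_one_of_mem_unipotentRadicalP F c (u := _ * p)
    (by rw [MonoidHom.mem_ker, map_mul, map_inv, leviProjection_leviEmbeddingP_apply, inv_mul_cancel]),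
    mul_one]

/-- Continuity of the Levi embedding (private copy of `continuous_blockDiagonalGL` of
`ParabolicSemidirect`, cf. `ParabolicGLProofs`). [folklore] -/
private theorem continuous_blockDiagonalGL'' : Continuous (blockDiagonalGL F c) := by
  haveI : IsTopologicalRing F := inferInstance
  have hval : Continuous fun m : (Π a, GL {i // c i = a} F) =>
      ((blockDiagonalGL F c m : GL n F) : Matrix n n F) := by
    have h : Continuous fun m : (Π a, GL {i // c i = a} F) => fun a =>
        ((m a : GL {i // c i = a} F) : Matrix {i // c i = a} {i // c i = a} F) :=
      continuous_pi fun a => Units.continuous_val.comp (continuous_apply a)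
    refine continuous_matrix fun i j => ?_
    simp_rw [blockDiagonalGL_apply_coe]
    exact h.matrix_blockDiagonal'.matrix_elem _ _
  refine Units.continuous_iff.2 ⟨hval, ?_⟩
  have : (fun m : (Π a, GL {i // c i = a} F) =>
      (((blockDiagonalGL F c m)⁻¹ : GL n F) : Matrix n n F)) =
        fun m => ((blockDiagonalGL F c m⁻¹ : GL n F) : Matrix n n F) := by
    funext m
    rw [map_inv]
  rw [this]
  exact hval.comp continuous_inv

/-- **`δ_{P_c}^{1/2} ∘ emb` is a smooth character of the Levi** `Π_a GL_{n_a}(F)`: its kernel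
contains the open subgroup `emb⁻¹(K₀ ∩ P_c)` for any compact open `K₀ ≤ GL_n(F)`, on whose image
the modular character of `P_c` is trivial. (Bernstein–Zelevinsky 1977, 1.7: the module of an
`ℓ`-group is locally constant.) [cite: BernsteinZelevinsky1977, 1.7] -/
theorem isOpen_ker_rootDeltaChar_comp_leviEmbeddingP :
    IsOpen ((((rootDeltaChar (standardParabolicGL F c)).comp (leviEmbeddingP F c)).ker :
      Set (Π a, GL {i // c i = a} F))) := by
  haveI : IsTopologicalRing F := inferInstance
  obtain ⟨K₀, hK₀c, hK₀o, -⟩ := exists_isCompact_isOpen_forall_standardParabolicGL_mul F c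
  refine Subgroup.isOpen_mono (H₁ := K₀.comap (blockDiagonalGL F c)) ?_ ?_
  · intro m hm
    rw [MonoidHom.mem_ker, MonoidHom.comp_apply]
    refine rootDeltaChar_eq_one_of_deltaChar_eq_one _ ?_
    have h1 : Measure.modularCharacter (leviEmbeddingP F c m) = 1 :=
      modularCharacter_eq_one_of_mem_comap_conj (isClosed_standardParabolicGL F c) hK₀o hK₀c
        (s := 1) (mem_comap_conj_symm_subtype.2 (by simpa using hm))
    ext
    rw [deltaChar_apply, h1, Units.val_one, NNReal.coe_one, Complex.ofReal_one]
  · exact hK₀o.preimage (continuous_blockDiagonalGL'' F c)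

/-- The inverse character `(δ_{P_c}^{1/2} ∘ emb)⁻¹` has the same (open) kernel. [folklore] -/
theorem isOpen_ker_rootDeltaChar_comp_leviEmbeddingP_inv :
    IsOpen ((((rootDeltaChar (standardParabolicGL F c)).comp (leviEmbeddingP F c))⁻¹.ker :
      Set (Π a, GL {i // c i = a} F))) := by
  have h : ((((rootDeltaChar (standardParabolicGL F c)).comp (leviEmbeddingP F c))⁻¹.ker :
      Set (Π a, GL {i // c i = a} F))) =
      ((rootDeltaChar (standardParabolicGL F c)).comp (leviEmbeddingP F c)).ker := by
    ext m
    simp [MonoidHom.mem_ker]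
  rw [h]
  exact isOpen_ker_rootDeltaChar_comp_leviEmbeddingP F c

end Modulus

end Literature.NumberTheory.Automorphic

/-! ### Frobenius assembly: from a quotient of the Jacquet module to an embedding into `i_c σ` -/

namespace Representation

open Literature.NumberTheory.Automorphic

variable (F : Type*) [Field F] [ValuativeRel F] [TopologicalSpace F] [IsNonarchimedeanLocalField F]
  {n : Type*} [Fintype n] [DecidableEq n] {α : Type*} [LinearOrder α] [Fintype α] (c : n → α)
  {V W₀ : Type*} [AddCommGroup V] [Module ℂ V] [AddCommGroup W₀] [Module ℂ W₀]

/-- The twisted datum `σ₀ ⊗ (δ^{1/2} ∘ emb)⁻¹` is irreducible when `σ₀` is. [folklore] -/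
theorem isIrreducible_twist_rootDeltaChar_inv (σ₀ : Representation ℂ (Π a, GL {i // c i = a} F) W₀)
    [σ₀.IsIrreducible] :
    (σ₀.twist ((rootDeltaChar (standardParabolicGL F c)).comp (leviEmbeddingP F c))⁻¹).IsIrreducible :=
  σ₀.isIrreducible_twist _

/-- The twisted datum `σ₀ ⊗ (δ^{1/2} ∘ emb)⁻¹` is smooth when `σ₀` is (the character is smooth,
`isOpen_ker_rootDeltaChar_comp_leviEmbeddingP_inv`). [folklore] -/
theorem IsSmooth.twist_rootDeltaChar_inv {σ₀ : Representation ℂ (Π a, GL {i // c i = a} F) W₀}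
    (hσ₀ : σ₀.IsSmooth) :
    (σ₀.twist ((rootDeltaChar (standardParabolicGL F c)).comp (leviEmbeddingP F c))⁻¹).IsSmooth := by
  haveI : IsTopologicalRing F := inferInstance
  exact hσ₀.twist (isOpen_ker_rootDeltaChar_comp_leviEmbeddingP_inv F c)

/-- **Frobenius assembly** (Bernstein–Zelevinsky 1977, Prop. 1.9 (b) with 2.4 (d); Casselman
1995, Thm. 3.2.4). Let `π` be an irreducible smooth representation of `GL_n(F)` and
`ψ : r_c π → σ₀` a non-zero intertwining map from its Jacquet module to a representation `σ₀` of
the Levi `Π_a GL_{n_a}(F)`. Put `σ = σ₀ ⊗ (δ_{P_c}^{1/2} ∘ emb)⁻¹`. Then `v ↦ ψ [v]` is a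
`P_c`-map `π|_{P_c} → σ ∘ proj ⊗ δ^{1/2}` (the two modulus factors cancel because
`δ^{1/2}(p) = δ^{1/2}(emb (proj p))`), its Frobenius transform
`v ↦ (g ↦ ψ [π(g) v])` (`Representation.frobeniusInv`) is a non-zero intertwining map
`π → i_c σ = Ind_{P_c}^{GL_n} (σ ∘ proj ⊗ δ^{1/2})` (`Representation.parabolicIndGL`), hence
injective by irreducibility of `π`. [cite: BernsteinZelevinsky1977, Prop. 1.9(b)] -/
theorem exists_injective_intertwiningMap_parabolicIndGL (π : Representation ℂ (GL n F) V)
    [π.IsIrreducible] (hπ : π.IsSmooth) (σ₀ : Representation ℂ (Π a, GL {i // c i = a} F) W₀)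
    (ψ : (jacquetGL F c π).IntertwiningMap σ₀) (hψ : ψ ≠ 0) :
    ∃ f : π.IntertwiningMap (parabolicIndGL F c
      (σ₀.twist ((rootDeltaChar (standardParabolicGL F c)).comp (leviEmbeddingP F c))⁻¹)),
      Function.Injective f := by
  haveI : IsTopologicalRing F := inferInstance
  set P := standardParabolicGL F c with hP
  set χ : (Π a, GL {i // c i = a} F) →* ℂˣ := (rootDeltaChar P).comp (leviEmbeddingP F c) with hχ
  -- the `P`-map `v ↦ ψ [v]`
  let Φ : IntertwiningMap (π.comp P.subtype)
      (Representation.twist ((σ₀.twist χ⁻¹).comp (leviProjection F c)) (rootDeltaChar P)) :=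
    { toLinearMap := ψ.toLinearMap ∘ₗ Coinvariants.mk (restrictUnipotentGL F c π)
      isIntertwining' := fun p => by
        refine LinearMap.ext fun v => ?_
        simp only [LinearMap.coe_comp, Function.comp_apply, MonoidHom.coe_comp, Subgroup.coe_subtype,
          IntertwiningMap.coe_toLinearMap]
        rw [← jacquetGL_leviProjection_mk F c π p v, ψ.isIntertwining, twist_apply,
          MonoidHom.coe_comp, Function.comp_apply, twist_apply, smul_smul]
        have hδ : rootDeltaChar P p = χ (leviProjection F c p) :=
          rootDeltaChar_eq_rootDeltaChar_leviEmbeddingP F c p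
        rw [hδ, MonoidHom.inv_apply, Units.val_inv_eq_inv_val,
          mul_inv_cancel₀ (Units.ne_zero _), one_smul] }
  have hΦ : ∀ v, Φ v = ψ (Coinvariants.mk (restrictUnipotentGL F c π) v) := fun v => rfl
  refine ⟨frobeniusInv hπ Φ, ?_⟩
  rcases IsIrreducible.injective_or_eq_zero (frobeniusInv hπ Φ) with h | h
  · exact h
  · exfalso
    apply hψ
    refine IntertwiningMap.ext (LinearMap.ext fun x => ?_)
    obtain ⟨v, rfl⟩ := Coinvariants.mk_surjective _ x
    have h1 : (frobeniusInv hπ Φ v).toFun 1 = Φ v := by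
      rw [toFun_frobeniusInv_apply, map_one, Module.End.one_apply]
    rw [h] at h1
    rw [IntertwiningMap.toLinearMap_apply, ← hΦ, ← h1]
    rfl

/-! ### Jacquet modules of irreducible smooth representations are finitely generated -/

/-- Continuity of the Levi embedding, for the smoothness of `r_c π` (private copy of
`continuous_blockDiagonalGL` of `ParabolicSemidirect`, as above). [folklore] -/
private theorem continuous_blockDiagonalGL₃ : Continuous (blockDiagonalGL F c) := by
  haveI : IsTopologicalRing F := inferInstance
  have hval : Continuous fun m : (Π a, GL {i // c i = a} F) =>
      ((blockDiagonalGL F c m : GL n F) : Matrix n n F) := by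
    have h : Continuous fun m : (Π a, GL {i // c i = a} F) => fun a =>
        ((m a : GL {i // c i = a} F) : Matrix {i // c i = a} {i // c i = a} F) :=
      continuous_pi fun a => Units.continuous_val.comp (continuous_apply a)
    refine continuous_matrix fun i j => ?_
    simp_rw [blockDiagonalGL_apply_coe]
    exact h.matrix_blockDiagonal'.matrix_elem _ _
  refine Units.continuous_iff.2 ⟨hval, ?_⟩
  have : (fun m : (Π a, GL {i // c i = a} F) =>
      (((blockDiagonalGL F c m)⁻¹ : GL n F) : Matrix n n F)) =
        fun m => ((blockDiagonalGL F c m⁻¹ : GL n F) : Matrix n n F) := by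
    funext m
    rw [map_inv]
  rw [this]
  exact hval.comp continuous_inv

/-- **The Jacquet module of a smooth representation is smooth**: the stabiliser of `[v]` in
`r_c π` contains the preimage of `Stab(v)` under the (continuous) Levi embedding.
(Bernstein–Zelevinsky 1977, §1.8; the `GL_n` form of `Representation.isSmooth_jacquetModule`.)
[cite: BernsteinZelevinsky1977, §1.8] -/
theorem IsSmooth.jacquetGL {π : Representation ℂ (GL n F) V} (hπ : π.IsSmooth) :
    (jacquetGL F c π).IsSmooth := by
  haveI : IsTopologicalRing F := inferInstance
  intro x
  obtain ⟨v, rfl⟩ := Coinvariants.mk_surjective _ x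
  refine (_root_.Representation.jacquetGL F c π).isSmoothVector_of_le
    (K := (π.stabilizerSubgroup v).comap (blockDiagonalGL F c))
    ((hπ v).preimage (continuous_blockDiagonalGL₃ F c)) fun m hm => ?_
  rw [Subgroup.mem_comap, mem_stabilizerSubgroup] at hm
  rw [mem_stabilizerSubgroup, jacquetGL_mk, hm]

/-- **Jacquet modules of irreducible smooth representations of `GL_n(F)` are finitely generated**
over the group algebra of the Levi `Π_a GL_{n_a}(F)`. With `GL_n(F) = P_c K₀` (Iwasawa, `K₀`
compact open) and `v₀ ≠ 0`: finitely many cosets `s · Stab(v₀)`, `s ∈ t`, cover `K₀`, so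
`π(g) v₀ = π(p) π(s) v₀` for every `g`; since the `π(g) v₀` span `V` (irreducibility) and
`[π(p) w] = r_c π (proj p) [w]`, the finitely many classes `[π(s) v₀]` generate `r_c π` over
`ℂ[Π_a GL_{n_a}(F)]`. (Bernstein–Zelevinsky 1977, Prop. 2.3 with Prop. 1.9 (c), (e): the functor
`r` carries finitely generated representations to finitely generated ones, `G` being compact
modulo `P`; Bernstein–Zelevinsky 1976, §3.) [cite: BernsteinZelevinsky1977, Prop. 2.3] -/
theorem finite_asModule_jacquetGL (π : Representation ℂ (GL n F) V) [π.IsIrreducible]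
    (hπ : π.IsSmooth) :
    Module.Finite (MonoidAlgebra ℂ (Π a, GL {i // c i = a} F)) (jacquetGL F c π).asModule := by
  haveI : IsTopologicalRing F := inferInstance
  -- a non-zero vector
  have hnt : (⊥ : Subrepresentation π) ≠ ⊤ := bot_ne_top
  obtain ⟨v₀, hv₀⟩ : ∃ v : V, v ≠ 0 := by
    by_contra h
    apply hnt
    refine le_antisymm bot_le fun w _ => ?_
    have hw : w = 0 := not_not.1 ((not_exists.1 h) w)
    rw [hw]
    exact (⊥ : Subrepresentation π).toSubmodule.zero_mem
  -- Iwasawa decomposition and finitely many cosets of `Stab(v₀)` in `K₀`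
  obtain ⟨K₀, hK₀c, -, hPK₀⟩ := exists_isCompact_isOpen_forall_standardParabolicGL_mul F c
  obtain ⟨t, ht⟩ := exists_finset_forall_inv_mul_mem hK₀c (K := π.stabilizerSubgroup v₀) (hπ v₀)
  -- the generators `[π(s) v₀]`, `s ∈ t`
  let gens : Set (restrictUnipotentGL F c π).Coinvariants :=
    (fun s : GL n F => Coinvariants.mk (restrictUnipotentGL F c π) (π s v₀)) '' (t : Set (GL n F))
  refine (jacquetGL F c π).finite_asModule_of_span_orbit_eq_top (s := gens)
    ((t.finite_toSet).image _) ?_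
  -- every class `[π(g) v₀]` is a translate of a generator
  set S : Submodule ℂ (restrictUnipotentGL F c π).Coinvariants :=
    Submodule.span ℂ {w | ∃ m : (Π a, GL {i // c i = a} F), ∃ x ∈ gens, w = jacquetGL F c π m x}
    with hS
  have horb : ∀ g : GL n F, Coinvariants.mk (restrictUnipotentGL F c π) (π g v₀) ∈ S := by
    intro g
    obtain ⟨p, hp, k₀, hk₀, rfl⟩ := hPK₀ g
    obtain ⟨s, hs, hsk⟩ := ht k₀ hk₀
    have hk : π k₀ v₀ = π s v₀ := by
      have h1 : π (s⁻¹ * k₀) v₀ = v₀ := hsk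
      calc π k₀ v₀ = π s (π (s⁻¹ * k₀) v₀) := by
            rw [← Module.End.mul_apply, ← map_mul, mul_inv_cancel_left]
        _ = π s v₀ := by rw [h1]
    rw [map_mul, Module.End.mul_apply, hk,
      ← jacquetGL_leviProjection_mk F c π ⟨p, hp⟩ (π s v₀)]
    exact Submodule.subset_span ⟨_, _, ⟨s, hs, rfl⟩, rfl⟩
  -- the `π(g) v₀` span `V`, so the `[π(g) v₀]` span the coinvariants
  refine eq_top_iff.2 fun x _ => ?_
  obtain ⟨v, rfl⟩ := Coinvariants.mk_surjective _ x
  obtain ⟨f, rfl⟩ := π.orbitCombination_surjective hv₀ v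
  have hmem : π.orbitCombination v₀ f ∈ Submodule.span ℂ (Set.range fun g : GL n F => π g v₀) := by
    rw [orbitCombination, ← Finsupp.range_linearCombination]
    exact LinearMap.mem_range_self _ f
  have hle : (Submodule.span ℂ (Set.range fun g : GL n F => π g v₀)).map
      (Coinvariants.mk (restrictUnipotentGL F c π)) ≤ S := by
    rw [Submodule.map_span, Submodule.span_le]
    rintro _ ⟨_, ⟨g, rfl⟩, rfl⟩
    exact horb g
  exact hle (Submodule.mem_map_of_mem hmem)

/-- **A non-zero Jacquet module of an irreducible smooth representation of `GL_n(F)` has an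
irreducible quotient**: being finitely generated over the group algebra of the Levi
(`finite_asModule_jacquetGL`), it has a maximal proper subrepresentation `N`
(`Representation.exists_isCoatom_subrepresentation`), and `r_c π ⧸ N` is irreducible
(`Subrepresentation.isIrreducible_quotientRep`). (Bernstein–Zelevinsky 1977, proof of Thm. 2.5 /
2.4; Bernstein–Zelevinsky 1976, §3.) [cite: BernsteinZelevinsky1977, Prop. 2.3] -/
theorem exists_isCoatom_subrepresentation_jacquetGL (π : Representation ℂ (GL n F) V)
    [π.IsIrreducible] (hπ : π.IsSmooth) [Nontrivial (restrictUnipotentGL F c π).Coinvariants] :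
    ∃ N : Subrepresentation (jacquetGL F c π), IsCoatom N := by
  haveI := finite_asModule_jacquetGL F c π hπ
  exact (jacquetGL F c π).exists_isCoatom_subrepresentation

end Representation
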